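import Summits.CriticalPhenomena.PercolationContinuityZ3.Theorems.PercNearOneGluingNoHeavyLowerTailAntitheticPendant
import HarnessLib

/-!
# `NoHeavyLowerTail` (stmt-CriticalPhenomena-4575) — antithetic cluster pairs: clusters on a CYCLE through the source (runs), the graph-side input of
# THEOREM C (BIC on cycles, every R; prim-hp-2 gen 39, HOME/THEOREM-C-cycles.md)

Support file (`--supports stmt-CriticalPhenomena-4575`, hull-port prover `prim-hp-2`, gen 39).  No named facts, no sorries; standard axioms.  The `def`s
`Antithetic.Cyc.{edge, edgeSet, pre, suf}` are proof-internal bookkeeping.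

SETTING.  A cycle through `s`: vertices `v 0 = s, v 1, …, v (n−1)` pairwise distinct (`v : ℕ → V` injective on `[0,n)`, `v n = v 0`, `n ≥ 3`), pairs
`edge i = v i v (i+1)` (`i < n`), `E = edgeSet`.  For a colouring `ω` (`edge i ∈ ω` = "red"): `pre ω` = length of the red run `edge 0, edge 1, …`,
`suf ω` = length of the red run `edge (n−1), edge (n−2), …` (both `= n` iff all red).
* `Cyc.reach_iff` — `v j`-type description of the vertices joined to `s`: `u` is reached iff `u = v j` with `j ≤ pre ω` or `u = v (n − j)` with `j ≤ suf ω`.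
* `Cyc.openEdgeCluster_eq` — the red EDGE cluster of `s` is `{edge i : i < pre ω ∨ n ≤ i + suf ω}` (the two runs).
* `Cyc.both_iff` — `v a` (`0 < a < n`) is joined to `s` in both colours iff the colouring is ONE-CHANGE at `a`: `edge i` red for `i < a` and blue for
  `a ≤ i < n`, or the reverse.  Hence the constraint set of `BIC(R)` on a cycle = all colourings except the one-change words at positions of `R`.
These are the inputs of the word calculus of THEOREM-C-cycles.md (staircase partition), to be formalised next.
[cite: VandenbergHaggstromKahn2005, §1 p. 3 (open cluster `C_s`)]
-/

noncomputable section

namespace Summit.CriticalPhenomena.PercolationContinuityZ3.Theorems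

open Literature.Probability.Percolation
open scoped Classical

namespace Antithetic

namespace Cyc

variable {V : Type*} (n : ℕ) (v : ℕ → V)

/-- The `i`-th pair of the cycle, `v i v (i+1)`. [this work] -/
def edge (i : ℕ) : Sym2 V := s(v i, v (i + 1))

/-- The edge set of the cycle `v 0, v 1, …, v (n−1), v n = v 0`. [this work] -/
def edgeSet : Set (Sym2 V) := {e | ∃ i, i < n ∧ e = edge v i}

/-- Length of the red run `edge 0, edge 1, …` of the colouring `ω` (`n` if everything is red). [this work] -/
def pre (ω : Set (Sym2 V)) : ℕ := Nat.find (⟨n, Or.inl rfl⟩ : ∃ a, a = n ∨ edge v a ∉ ω)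

/-- Length of the red run `edge (n−1), edge (n−2), …` of the colouring `ω` (`n` if everything is red). [this work] -/
def suf (ω : Set (Sym2 V)) : ℕ := Nat.find (⟨n, Or.inl rfl⟩ : ∃ b, b = n ∨ edge v (n - 1 - b) ∉ ω)

variable {n v} (ω : Set (Sym2 V))

/-- `pre ω ≤ n`. -/
theorem pre_le : pre n v ω ≤ n := Nat.find_le (Or.inl rfl)

/-- `suf ω ≤ n`. -/
theorem suf_le : suf n v ω ≤ n := Nat.find_le (Or.inl rfl)

/-- The pairs before `pre ω` are red. -/
theorem red_of_lt_pre {i : ℕ} (hi : i < pre n v ω) : edge v i ∈ ω := by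
  have h := Nat.find_min (⟨n, Or.inl rfl⟩ : ∃ a, a = n ∨ edge v a ∉ ω) hi
  push Not at h
  exact h.2

/-- The pair at `pre ω` (if any) is blue. -/
theorem not_red_pre (h : pre n v ω < n) : edge v (pre n v ω) ∉ ω := by
  have := Nat.find_spec (⟨n, Or.inl rfl⟩ : ∃ a, a = n ∨ edge v a ∉ ω)
  exact this.resolve_left (Nat.ne_of_lt h)

/-- The last `suf ω` pairs are red. -/
theorem red_of_lt_suf {j : ℕ} (hj : j < suf n v ω) : edge v (n - 1 - j) ∈ ω := by
  have h := Nat.find_min (⟨n, Or.inl rfl⟩ : ∃ b, b = n ∨ edge v (n - 1 - b) ∉ ω) hj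
  push Not at h
  exact h.2

/-- The pair just before the suffix run (if any) is blue. -/
theorem not_red_suf (h : suf n v ω < n) : edge v (n - 1 - suf n v ω) ∉ ω := by
  have := Nat.find_spec (⟨n, Or.inl rfl⟩ : ∃ b, b = n ∨ edge v (n - 1 - b) ∉ ω)
  exact this.resolve_left (Nat.ne_of_lt h)

/-- `pre` is the largest red prefix: if the first `a ≤ n` pairs are red then `a ≤ pre ω`. -/
theorem le_pre {a : ℕ} (ha : a ≤ n) (hred : ∀ i, i < a → edge v i ∈ ω) : a ≤ pre n v ω := by
  by_contra h
  push Not at h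
  have hlt : pre n v ω < n := lt_of_lt_of_le h ha
  exact not_red_pre ω hlt (hred _ h)

/-- `suf` is the largest red suffix. -/
theorem le_suf {b : ℕ} (hb : b ≤ n) (hred : ∀ j, j < b → edge v (n - 1 - j) ∈ ω) : b ≤ suf n v ω := by
  by_contra h
  push Not at h
  exact not_red_suf ω (lt_of_lt_of_le h hb) (hred _ h)

section Structure

variable (hn : 3 ≤ n) (hinj : ∀ i j, i < n → j < n → v i = v j → i = j) (hper : v n = v 0)
include hn hinj hper

/-- Consecutive vertices of the cycle are distinct. -/
theorem v_ne_succ {i : ℕ} (hi : i < n) : v i ≠ v (i + 1) := by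
  intro h
  by_cases hi1 : i + 1 < n
  · exact absurd (hinj i (i + 1) hi hi1 h) (by omega)
  · have : i + 1 = n := by omega
    rw [this, hper] at h
    have := hinj i 0 hi (by omega) h
    omega

/-- Index identification on the cycle: `v i = v j` with `i, j ≤ n` forces `i = j` up to the identification `v n = v 0`. -/
theorem idx_eq {i j : ℕ} (hi : i ≤ n) (hj : j ≤ n) (h : v i = v j) : i = j ∨ (i = 0 ∧ j = n) ∨ (i = n ∧ j = 0) := by
  rcases Nat.lt_or_ge i n with hi' | hi'
  · rcases Nat.lt_or_ge j n with hj' | hj'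
    · exact Or.inl (hinj i j hi' hj' h)
    · have hjn : j = n := le_antisymm hj hj'
      rw [hjn, hper] at h
      exact Or.inr (Or.inl ⟨hinj i 0 hi' (by omega) h, hjn⟩)
  · have hin : i = n := le_antisymm hi hi'
    rcases Nat.lt_or_ge j n with hj' | hj'
    · rw [hin, hper] at h
      exact Or.inr (Or.inr ⟨hin, (hinj 0 j (by omega) hj' h).symm⟩)
    · exact Or.inl (hin.trans (le_antisymm hj hj').symm)

/-- The vertices joined to `s = v 0` by red pairs: the prefix run and the suffix run. -/
theorem reach_of_prefix {j : ℕ} (hj : j ≤ pre n v ω) : (openGraph (ω ∩ edgeSet n v)).Reachable (v 0) (v j) := by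
  induction j with
  | zero => exact SimpleGraph.Reachable.refl _
  | succ j ih =>
    have hjn : j < n := lt_of_lt_of_le (Nat.lt_of_succ_le hj) (pre_le ω)
    refine (ih (Nat.le_of_succ_le hj)).trans
      ((openGraph_adj (ω ∩ edgeSet n v) (v j) (v (j + 1))).2 ⟨⟨red_of_lt_pre ω hj, j, hjn, rfl⟩, v_ne_succ hn hinj hper hjn⟩).reachable

/-- The suffix run is joined to `s`. -/
theorem reach_of_suffix {j : ℕ} (hj : j ≤ suf n v ω) : (openGraph (ω ∩ edgeSet n v)).Reachable (v 0) (v (n - j)) := by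
  induction j with
  | zero => rw [Nat.sub_zero, hper]
  | succ j ih =>
    have hjn : j < n := lt_of_lt_of_le (Nat.lt_of_succ_le hj) (suf_le ω)
    refine (ih (Nat.le_of_succ_le hj)).trans ?_
    have hidx : n - 1 - j + 1 = n - j := by omega
    have hadj : (openGraph (ω ∩ edgeSet n v)).Adj (v (n - 1 - j)) (v (n - j)) := by
      rw [openGraph_adj]
      refine ⟨⟨?_, n - 1 - j, by omega, ?_⟩, ?_⟩
      · have := red_of_lt_suf ω hj; rwa [edge, hidx] at this
      · rw [edge, hidx]
      · have := v_ne_succ hn hinj hper (i := n - 1 - j) (by omega); rwa [hidx] at this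
    rw [show n - (j + 1) = n - 1 - j by omega]
    exact hadj.symm.reachable

/-- **Reach on a cycle.**  `u` is joined to `s = v 0` by red pairs iff `u = v j` with `j ≤ pre ω` or `u = v (n − j)` with `j ≤ suf ω`. [this work] -/
theorem reach_iff (u : V) : (openGraph (ω ∩ edgeSet n v)).Reachable (v 0) u ↔
    ∃ j, (j ≤ pre n v ω ∧ u = v j) ∨ (j ≤ suf n v ω ∧ u = v (n - j)) := by
  constructor
  · -- the set on the right contains `v 0` and is closed under red adjacency
    suffices hcl : ∀ u u', (∃ j, (j ≤ pre n v ω ∧ u = v j) ∨ (j ≤ suf n v ω ∧ u = v (n - j))) →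
        (openGraph (ω ∩ edgeSet n v)).Adj u u' → ∃ j, (j ≤ pre n v ω ∧ u' = v j) ∨ (j ≤ suf n v ω ∧ u' = v (n - j)) by
      rintro ⟨p⟩
      generalize hs : v 0 = s₀ at p
      induction p using SimpleGraph.Walk.concatRec with
      | Hnil => exact ⟨0, Or.inl ⟨Nat.zero_le _, hs.symm⟩⟩
      | Hconcat p h ih => exact hcl _ _ (ih hs) h
    rintro u u' ⟨j, hj⟩ hadj
    rw [openGraph_adj] at hadj
    obtain ⟨⟨hred, i, hi, he⟩, hne⟩ := hadj
    -- {u, u'} = {v i, v (i+1)} with `edge i` red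
    have hred' : edge v i ∈ ω := by rw [← he]; exact hred
    have huu' : (u = v i ∧ u' = v (i + 1)) ∨ (u = v (i + 1) ∧ u' = v i) := by
      have := Sym2.eq_iff.1 he
      rcases this with ⟨h1, h2⟩ | ⟨h1, h2⟩
      · exact Or.inl ⟨h1, h2⟩
      · exact Or.inr ⟨h1, h2⟩
    -- all red: everything is reached along the prefix
    by_cases hall : pre n v ω = n
    · rcases huu' with ⟨-, rfl⟩ | ⟨-, rfl⟩
      · by_cases hi1 : i + 1 < n
        · exact ⟨i + 1, Or.inl ⟨by omega, rfl⟩⟩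
        · exact ⟨0, Or.inl ⟨Nat.zero_le _, by rw [show i + 1 = n by omega, hper]⟩⟩
      · exact ⟨i, Or.inl ⟨by omega, rfl⟩⟩
    have hpn : pre n v ω < n := lt_of_le_of_ne (pre_le ω) hall
    -- if the last pair is red then the suffix run is nonempty, and symmetrically
    have hsuf1 : edge v (n - 1) ∈ ω → 1 ≤ suf n v ω := fun h => le_suf ω (by omega) fun j hj => by
      rw [show j = 0 by omega, Nat.sub_zero]; exact h
    have hpre1 : edge v 0 ∈ ω → 1 ≤ pre n v ω := fun h => le_pre ω (by omega) fun j hj => by rw [show j = 0 by omega]; exact h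
    rcases hj with ⟨hjp, rfl⟩ | ⟨hjs, rfl⟩
    · -- u = v j on the prefix run
      have hjn : j ≤ n := hjp.trans (pre_le ω)
      rcases huu' with ⟨h1, rfl⟩ | ⟨h1, rfl⟩
      · -- u = v i, u' = v (i+1)
        rcases idx_eq hn hinj hper hjn hi.le h1 with hji | ⟨hj0, hin⟩ | ⟨hjn', hi0⟩
        · subst hji
          by_cases hlt : j < pre n v ω
          · exact ⟨j + 1, Or.inl ⟨hlt, rfl⟩⟩
          · exact absurd hred' (by rw [show j = pre n v ω by omega]; exact not_red_pre ω hpn)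
        · omega
        · subst hi0
          exact ⟨1, Or.inl ⟨hpre1 hred', rfl⟩⟩
      · -- u = v (i+1), u' = v i
        rcases idx_eq hn hinj hper hjn (by omega : i + 1 ≤ n) h1 with hji | ⟨hj0, hin⟩ | ⟨hjn', hi0⟩
        · exact ⟨i, Or.inl ⟨by omega, rfl⟩⟩
        · -- j = 0, i + 1 = n: u' = v (n-1), reached through the suffix
          refine ⟨1, Or.inr ⟨hsuf1 (by rw [show n - 1 = i by omega]; exact hred'), by rw [show n - 1 = i by omega]⟩⟩
        · omega
    · -- u = v (n - j) on the suffix run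
      have hsn : suf n v ω < n := by
        by_contra hs
        have hs' : suf n v ω = n := le_antisymm (suf_le ω) (by omega)
        apply hall
        refine le_antisymm (pre_le ω) (le_pre ω le_rfl fun i' hi' => ?_)
        have := red_of_lt_suf (n := n) (v := v) ω (j := n - 1 - i') (by omega)
        rwa [show n - 1 - (n - 1 - i') = i' by omega] at this
      rcases huu' with ⟨h1, rfl⟩ | ⟨h1, rfl⟩
      · -- v (n-j) = v i, u' = v (i+1)
        rcases idx_eq hn hinj hper (Nat.sub_le n j) hi.le h1 with hji | ⟨hj0, hin⟩ | ⟨hjn', hi0⟩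
        · -- i = n - j: the pair `edge (n-j)` is red, so it lies in the suffix run: j ≥ 1 and u' = v (n - (j-1))
          by_cases hj0 : j = 0
          · subst hj0
            rw [Nat.sub_zero] at hji
            omega
          · refine ⟨j - 1, Or.inr ⟨by omega, by rw [← hji]; congr 1; omega⟩⟩
        · omega
        · -- n - j = n and i = 0: j = 0... then u = v n = v 0 and u' = v 1
          subst hi0
          exact ⟨1, Or.inl ⟨hpre1 hred', rfl⟩⟩
      · -- v (n-j) = v (i+1), u' = v i : going further down the suffix
        rcases idx_eq hn hinj hper (Nat.sub_le n j) (by omega : i + 1 ≤ n) h1 with hji | ⟨hj0, hin⟩ | ⟨hjn', hi0⟩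
        · -- i + 1 = n - j, u' = v i = v (n - (j+1)); need j + 1 ≤ suf: pairs n-1-j' red for j' ≤ j
          have hjs' : j + 1 ≤ suf n v ω := by
            by_contra hlt
            have hjeq : j = suf n v ω := by omega
            have := not_red_suf ω hsn
            rw [← hjeq, show n - 1 - j = i by omega] at this
            exact this hred'
          exact ⟨j + 1, Or.inr ⟨hjs', by congr 1; omega⟩⟩
        · -- n - j = 0: j = n > suf: impossible
          omega
        · omega
  · rintro ⟨j, ⟨hj, rfl⟩ | ⟨hj, rfl⟩⟩
    · exact reach_of_prefix ω hn hinj hper hj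
    · exact reach_of_suffix ω hn hinj hper hj

/-- **The red edge cluster of `s` on a cycle** = the prefix run together with the suffix run. [this work] -/
theorem openEdgeCluster_eq : openEdgeCluster (ω ∩ edgeSet n v) (v 0) = {e | ∃ i, i < n ∧ e = edge v i ∧ (i < pre n v ω ∨ n ≤ i + suf n v ω)} := by
  ext e
  rw [mem_openEdgeCluster_iff]
  constructor
  · rintro ⟨⟨hred, i, hi, rfl⟩, -, hr⟩
    refine ⟨i, hi, rfl, ?_⟩
    have h0 := (reach_iff ω hn hinj hper _).1 (hr (v i) (Sym2.mem_mk_left _ _))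
    have h1 := (reach_iff ω hn hinj hper _).1 (hr (v (i + 1)) (Sym2.mem_mk_right _ _))
    by_contra hno
    push Not at hno
    obtain ⟨hip, his⟩ := hno
    -- `v i` reached: in the prefix it must be `i ≤ pre`, hence `i = pre` (blue pair) — contradiction; in the suffix `i ≥ n - suf` contradicts `his`
    have hpn : pre n v ω < n := by omega
    obtain ⟨j, ⟨hj, hji⟩ | ⟨hj, hji⟩⟩ := h0
    · rcases idx_eq hn hinj hper hi.le (hj.trans (pre_le ω)) hji with h | ⟨hi0, hjn⟩ | ⟨hin, -⟩
      · have : i = pre n v ω := by omega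
        exact not_red_pre ω hpn (this ▸ hred)
      · omega
      · omega
    · rcases idx_eq hn hinj hper hi.le (Nat.sub_le n j) hji with h | ⟨hi0, hjn⟩ | ⟨hin, -⟩
      · -- i = n - j with j ≤ suf, but i + suf < n forces j = 0, i = n: contradiction with i < n
        omega
      · -- i = 0 and n - j = n, i.e. nothing learned; use the other endpoint v 1
        subst hi0
        obtain ⟨j', ⟨hj', hji'⟩ | ⟨hj', hji'⟩⟩ := h1
        · rcases idx_eq hn hinj hper (by omega : 1 ≤ n) (hj'.trans (pre_le ω)) hji' with h | ⟨h, -⟩ | ⟨h, -⟩ <;> omega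
        · rcases idx_eq hn hinj hper (by omega : 1 ≤ n) (Nat.sub_le n j') hji' with h | ⟨h, -⟩ | ⟨h, -⟩
          · -- 1 = n - j', j' ≤ suf: then suf ≥ n - 1 and the pair `edge 0`... `i + suf < n` with i = 0 gives suf < n; pairs n-1-j'' red for j'' < suf
            -- edge 0 red (hred) and edges 1..n-1 red ⇒ pre = n, contradiction with hip : ¬ 0 < pre
            have hsuf : n - 1 ≤ suf n v ω := by omega
            have hpe : pre n v ω = n := le_antisymm (pre_le ω) (le_pre ω le_rfl fun k hk => by
              by_cases hk0 : k = 0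
              · subst hk0; exact hred
              · have := red_of_lt_suf (n := n) (v := v) ω (j := n - 1 - k) (by omega)
                rwa [show n - 1 - (n - 1 - k) = k by omega] at this)
            omega
          · omega
          · omega
      · omega
  · rintro ⟨i, hi, rfl, hrun⟩
    have hred : edge v i ∈ ω := by
      rcases hrun with h | h
      · exact red_of_lt_pre ω h
      · have := red_of_lt_suf (n := n) (v := v) ω (j := n - 1 - i) (by omega)
        rwa [show n - 1 - (n - 1 - i) = i by omega] at this
    refine ⟨⟨hred, i, hi, rfl⟩, ?_, fun u hu => ?_⟩
    · rw [edge, Sym2.mk_isDiag_iff]; exact v_ne_succ hn hinj hper hi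
    · rw [reach_iff ω hn hinj hper]
      rcases Sym2.mem_iff.1 hu with rfl | rfl
      · rcases hrun with h | h
        · exact ⟨i, Or.inl ⟨h.le, rfl⟩⟩
        · exact ⟨n - i, Or.inr ⟨by omega, by congr 1; omega⟩⟩
      · rcases hrun with h | h
        · exact ⟨i + 1, Or.inl ⟨h, rfl⟩⟩
        · by_cases hi1 : i + 1 = n
          · exact ⟨0, Or.inl ⟨Nat.zero_le _, by rw [hi1, hper]⟩⟩
          · exact ⟨n - (i + 1), Or.inr ⟨by omega, by congr 1; omega⟩⟩

/-- Red reach of a cycle vertex `v a` (`0 < a < n`): iff the prefix run or the suffix run covers it. [this work] -/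
theorem reach_v_iff {a : ℕ} (ha0 : 0 < a) (han : a < n) :
    (openGraph (ω ∩ edgeSet n v)).Reachable (v 0) (v a) ↔ a ≤ pre n v ω ∨ n ≤ a + suf n v ω := by
  rw [reach_iff ω hn hinj hper]
  constructor
  · rintro ⟨j, ⟨hj, hja⟩ | ⟨hj, hja⟩⟩
    · rcases idx_eq hn hinj hper han.le (hj.trans (pre_le ω)) hja with h | ⟨h, -⟩ | ⟨h, -⟩
      · exact Or.inl (h ▸ hj)
      · omega
      · omega
    · rcases idx_eq hn hinj hper han.le (Nat.sub_le n j) hja with h | ⟨h, -⟩ | ⟨h, -⟩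
      · right; have := suf_le (n := n) (v := v) ω; omega
      · omega
      · omega
  · rintro (h | h)
    · exact ⟨a, Or.inl ⟨h, rfl⟩⟩
    · exact ⟨n - a, Or.inr ⟨by omega, by congr 1; omega⟩⟩

/-- **Doubly reached ⟺ one-change.**  For `0 < a < n`, the vertex `v a` is joined to `s` both by red and by blue pairs iff the colouring is one-change at
`a`: the pairs `edge i`, `i < a`, have one colour and the pairs `edge i`, `a ≤ i < n`, the other. [this work] -/
theorem both_iff {a : ℕ} (ha0 : 0 < a) (han : a < n) :
    ((openGraph (ω ∩ edgeSet n v)).Reachable (v 0) (v a) ∧ (openGraph (ωᶜ ∩ edgeSet n v)).Reachable (v 0) (v a)) ↔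
      ((∀ i, i < a → edge v i ∈ ω) ∧ (∀ i, a ≤ i → i < n → edge v i ∉ ω)) ∨
        ((∀ i, i < a → edge v i ∉ ω) ∧ (∀ i, a ≤ i → i < n → edge v i ∈ ω)) := by
  rw [reach_v_iff ω hn hinj hper ha0 han, reach_v_iff ωᶜ hn hinj hper ha0 han]
  -- translations between runs and colour patterns
  have P1 : a ≤ pre n v ω ↔ ∀ i, i < a → edge v i ∈ ω :=
    ⟨fun h i hi => red_of_lt_pre ω (lt_of_lt_of_le hi h), fun h => le_pre ω han.le h⟩
  have P2 : a ≤ pre n v ωᶜ ↔ ∀ i, i < a → edge v i ∉ ω :=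
    ⟨fun h i hi => red_of_lt_pre ωᶜ (lt_of_lt_of_le hi h), fun h => le_pre ωᶜ han.le h⟩
  have S1 : n ≤ a + suf n v ω ↔ ∀ i, a ≤ i → i < n → edge v i ∈ ω := by
    constructor
    · intro h i hai hin
      have := red_of_lt_suf (n := n) (v := v) ω (j := n - 1 - i) (by omega)
      rwa [show n - 1 - (n - 1 - i) = i by omega] at this
    · intro h
      have := le_suf (n := n) (v := v) ω (b := n - a) (by omega) fun j hj => h _ (by omega) (by omega)
      omega
  have S2 : n ≤ a + suf n v ωᶜ ↔ ∀ i, a ≤ i → i < n → edge v i ∉ ω := by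
    constructor
    · intro h i hai hin
      have := red_of_lt_suf (n := n) (v := v) ωᶜ (j := n - 1 - i) (by omega)
      rwa [show n - 1 - (n - 1 - i) = i by omega] at this
    · intro h
      have := le_suf (n := n) (v := v) ωᶜ (b := n - a) (by omega) fun j hj => h _ (by omega) (by omega)
      omega
  rw [P1, P2, S1, S2]
  constructor
  · rintro ⟨h1 | h1, h2 | h2⟩
    · exact absurd (h1 0 ha0) (h2 0 ha0)
    · exact Or.inl ⟨h1, h2⟩
    · exact Or.inr ⟨h2, h1⟩
    · exact absurd (h1 (n - 1) (by omega) (by omega)) (h2 (n - 1) (by omega) (by omega))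
  · rintro (⟨h1, h2⟩ | ⟨h1, h2⟩)
    · exact ⟨Or.inl h1, Or.inr h2⟩
    · exact ⟨Or.inr h2, Or.inl h1⟩

end Structure

end Cyc

end Antithetic

end Summit.CriticalPhenomena.PercolationContinuityZ3.Theorems
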